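import Literature.InformationTheory.QuantumCodes.QuantumSingletonBound
import Literature.InformationTheory.QuantumCodes.LocalityBounds
import HarnessLib

/-!
# Bravyi–Terhal 2009, Theorem 1: `d ≤ r · L^{D−1}` for stabilizer codes with `r`-local generators — proof

S. Bravyi, B. Terhal, *A no-go theorem for a two-dimensional self-correcting quantum memory based on
stabilizer codes*, New J. Phys. 11 (2009) 043029 = arXiv:0810.1983 [BravyiTerhal2009], §1.1 Theorem 1:
«Let `S = ⟨S_1,…,S_m⟩` be a stabilizer code on a `D`-dimensional lattice `Λ = {1,…,L}^D`. Suppose the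
support of any generator `S_a` can be bounded by a hypercube with `r^D` vertices. Then the distance of `S`
satisfies `d ≤ r L^{D−1}`.» The tree states it (open boundary conditions, all `L`, `k ≥ 1`) as the
named fact `BravyiTerhal2009_d_le_c_sqrt_n` (`LocalityBounds.lean`); this file PROVES it:
`BravyiTerhal2009_d_le_c_sqrt_n_holds`.

## Proof (BT09 §2: Cleaning Lemma + Prop. 1, organised so that every `L` is covered)

Slice the lattice along the first coordinate into consecutive slabs of `w = max(r−1, 1)` columns (the
last slab may be thinner). A generator spans at most `r ≤ w + 1` consecutive columns, hence meets at most
two ADJACENT slabs (`slabPair_of_isCubeLocal`). Abstractly (section `Core`, for any slab index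
`β : qubits → ℕ` with that property): if no non-trivial logical operator is supported inside a single
slab, then (i) an element of `S̄⊥` supported on the slabs of one parity splits slab by slab into elements
of `S̄⊥` (a generator meets at most one slab of a given parity), each a stabilizer by hypothesis, so it
is a stabilizer (`mem_of_mem_supportedOn_parityClass`); (ii) by (i) for the odd slabs and the Cleaning
Lemma in dimension form (`sup_sympDual_inf_supportedOn_compl_eq`, `QuantumSingletonBound.lean`) every
`P ∈ S̄⊥` is a stabilizer plus an element of `S̄⊥` supported on the even slabs, which by (i) is again a
stabilizer: `S̄⊥ ≤ S̄`, i.e. `k = 0` (`sympDual_le_of_slabs`). Hence for `k ≥ 1` some slab supports a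
non-trivial logical operator, of weight `≤ w · L^{D−1} ≤ r · L^{D−1}` (`card_colSlab_le`). (BT09 prove
Prop. 1 with slabs of widths `r−1`, `r` in even number, which needs `L ≥ 2(r−1)²` and serves periodic
boundaries too; with open boundaries no parity constraint arises, so all `L` are covered, matching the
printed Theorem 1, which has no restriction on `L`.)

## References

* [BravyiTerhal2009] §1.1 Thm 1 (arXiv:0810.1983 chunk p0004), §2 Lemma 1, Def. 1, Prop. 1 and the
  proof of Thm 1 (chunks p0009–p0010).

## Mathlib / tree search

Tree: `supportedOn`, `proj`, `proj_eq_self_of_mem`, `sympInner_eq_zero_of_supportedOn_compl`,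
`sympWeight_le_card_of_mem`, `sup_sympDual_inf_supportedOn_compl_eq` (QuantumSingletonBound.lean);
`sympSupport`, `InCube`, `IsCubeLocal`, `HasLocalGenerators`, `BravyiTerhal2009_d_le_c_sqrt_n`
(LocalityBounds.lean); `IsAdditiveCode.finrank_sympDual`, `mem_sympDual_iff`, `sympInner_add_left`,
`sympInner_smul_left` (SymplecticCodes.lean). Mathlib: `Equiv.piFinSucc`, `Fintype.card_fun`.
-/

namespace Literature.InformationTheory.QuantumCodes

open Matrix Finset Module

variable {n : ℕ}

/-! ### Two general facts on the symplectic vocabulary -/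

/-- A vector orthogonal to every generator is orthogonal to their span.
[cite: CalderbankEtAl1998, §2 (printed p. 4: S̄⊥ taken with respect to the inner product (1))] -/
theorem mem_sympDual_span_of_forall {ι : Type*} (g : ι → SympVec n) {v : SympVec n}
    (h : ∀ a, sympInner (g a) v = 0) : v ∈ sympDual (Submodule.span (ZMod 2) (Set.range g)) := by
  rw [mem_sympDual_iff]
  intro u hu
  induction hu using Submodule.span_induction with
  | mem x hx => obtain ⟨a, rfl⟩ := hx; exact h a
  | zero => simp [sympInner]
  | add x y _ _ hx hy => rw [sympInner_add_left, hx, hy, add_zero]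
  | smul c x _ hx => simp [sympInner_smul_left, hx]

/-- `⟨u, Σ_j v_j⟩ = Σ_j ⟨u, v_j⟩`. [cite: CalderbankEtAl1998, §2 eq. (1) (bilinearity)] -/
theorem sympInner_sum_right {ι : Type*} (u : SympVec n) (s : Finset ι) (v : ι → SympVec n) :
    sympInner u (∑ j ∈ s, v j) = ∑ j ∈ s, sympInner u (v j) := by
  induction s using Finset.cons_induction with
  | empty => simp [sympInner]
  | cons a s ha ih =>
    rw [Finset.sum_cons, Finset.sum_cons, sympInner_comm, sympInner_add_left, sympInner_comm (v a),
      sympInner_comm (∑ j ∈ s, v j), ih]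

/-- A vector whose support misses `M` is supported on `Mᶜ`. [cite: BravyiTerhal2009, §2 (support of an operator)] -/
theorem mem_supportedOn_compl_of_forall_sympSupport {M : Finset (Fin n)} {v : SympVec n}
    (h : ∀ q ∈ sympSupport v, q ∉ M) : v ∈ supportedOn Mᶜ := by
  intro q hq
  rw [mem_compl, not_not] at hq
  by_contra hne
  refine h q ?_ hq
  simp only [sympSupport, mem_filter, mem_univ, true_and]
  tauto

/-! ### Core: slabs indexed by `β`, generators meeting at most two adjacent slabs -/

section Core

variable (β : Fin n → ℕ)

/-- The slab of index `j`: the qubits `q` with `β q = j`.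
[cite: BravyiTerhal2009, §2 proof of Prop. 1 (the vertical strips A_1, …, A_K)] -/
def slab (j : ℕ) : Finset (Fin n) := univ.filter fun q => β q = j

/-- The union of the slabs of parity `p` (`p = 0`: «even strips», `p = 1`: «odd strips»).
[cite: BravyiTerhal2009, §2 proof of Prop. 1] -/
def parityClass (p : ℕ) : Finset (Fin n) := univ.filter fun q => β q % 2 = p

/-- Membership in a slab. [cite: BravyiTerhal2009, §2 proof of Prop. 1] -/
@[simp] theorem mem_slab {j : ℕ} {q : Fin n} : q ∈ slab β j ↔ β q = j := by simp [slab]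

/-- Membership in a parity class. [cite: BravyiTerhal2009, §2 proof of Prop. 1] -/
@[simp] theorem mem_parityClass {p : ℕ} {q : Fin n} : q ∈ parityClass β p ↔ β q % 2 = p := by
  simp [parityClass]

/-- The complement of the odd slabs is the even slabs. [cite: BravyiTerhal2009, §2 proof of Prop. 1] -/
theorem compl_parityClass_one : (parityClass β 1)ᶜ = parityClass β 0 := by
  ext q; simp only [mem_compl, mem_parityClass]; omega

/-- The slab indices of parity `p` that occur. [cite: BravyiTerhal2009, §2 proof of Prop. 1] -/
def slabIndices (p : ℕ) : Finset ℕ := (univ.image β).filter fun j => j % 2 = p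

/-- A vector supported on the slabs of parity `p` is the sum of its restrictions to those slabs
(`P' = P'_1 P'_3 ⋯ P'_{K−1}`). [cite: BravyiTerhal2009, §2 proof of Prop. 1] -/
theorem eq_sum_proj_slab {p : ℕ} {P : SympVec n} (hP : P ∈ supportedOn (parityClass β p)) :
    P = ∑ j ∈ slabIndices β p, proj (slab β j) P := by
  have hmem : ∀ q : Fin n, β q ∈ slabIndices β p ↔ β q % 2 = p := fun q => by
    simp only [slabIndices, mem_filter, mem_image, mem_univ, true_and, exists_apply_eq_apply, true_and]
  ext q
  · simp only [Prod.fst_sum, Finset.sum_apply, proj_apply_fst, mem_slab, Finset.sum_ite_eq]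
    by_cases h : β q % 2 = p
    · rw [if_pos ((hmem q).2 h)]
    · rw [if_neg (fun h' => h ((hmem q).1 h'))]
      exact (hP q (by simpa using h)).1
  · simp only [Prod.snd_sum, Finset.sum_apply, proj_apply_snd, mem_slab, Finset.sum_ite_eq]
    by_cases h : β q % 2 = p
    · rw [if_pos ((hmem q).2 h)]
    · rw [if_neg (fun h' => h ((hmem q).1 h'))]
      exact (hP q (by simpa using h)).2

variable {ι : Type*} (g : ι → SympVec n)

-- Hypothesis `hsep` below: every generator meets at most two ADJACENT slabs («each generator overlaps
-- with at most one even strip / at most one odd strip», [BravyiTerhal2009, §2 proof of Prop. 1]):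
--   `∀ a, ∃ j₀, ∀ q ∈ sympSupport (g a), β q = j₀ ∨ β q = j₀ + 1`.

/-- A generator not meeting slab `j` is orthogonal to anything restricted to slab `j`.
[cite: BravyiTerhal2009, §2 proof of Prop. 1] -/
theorem sympInner_proj_slab_eq_zero {a : ι} {j : ℕ} (h : ∀ q ∈ sympSupport (g a), β q ≠ j)
    (P : SympVec n) : sympInner (g a) (proj (slab β j) P) = 0 := by
  have hg : g a ∈ supportedOn (slab β j)ᶜ :=
    mem_supportedOn_compl_of_forall_sympSupport fun q hq hqj => h q hq (by simpa using hqj)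
  rw [sympInner_comm]
  exact sympInner_eq_zero_of_supportedOn_compl (proj_mem_supportedOn _ P) hg

/-- If `P ∈ ⟨g⟩⊥` is supported on the slabs of one parity, each of its slab pieces is in `⟨g⟩⊥`
(«Locality of the generators implies that each generator overlaps with at most one odd strip», so
`P'_j ∈ C(S)`). [cite: BravyiTerhal2009, §2 proof of Prop. 1] -/
theorem proj_slab_mem_sympDual (hsep : ∀ a, ∃ j₀ : ℕ, ∀ q ∈ sympSupport (g a), β q = j₀ ∨ β q = j₀ + 1) {p : ℕ} {P : SympVec n}
    (hPd : P ∈ sympDual (Submodule.span (ZMod 2) (Set.range g)))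
    (hPs : P ∈ supportedOn (parityClass β p)) {j : ℕ} (hj : j % 2 = p) :
    proj (slab β j) P ∈ sympDual (Submodule.span (ZMod 2) (Set.range g)) := by
  refine mem_sympDual_span_of_forall g fun a => ?_
  by_cases hmeet : ∃ q ∈ sympSupport (g a), β q = j
  · obtain ⟨q₀, hq₀, hq₀j⟩ := hmeet
    obtain ⟨j₀, hj₀⟩ := hsep a
    have hother : ∀ j' ∈ slabIndices β p, j' ≠ j → sympInner (g a) (proj (slab β j') P) = 0 := by
      intro j' hj' hne
      refine sympInner_proj_slab_eq_zero β g (fun q hq hqj' => ?_) P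
      have h1 := hj₀ q₀ hq₀
      have h2 := hj₀ q hq
      have hp' : j' % 2 = p := (mem_filter.1 hj').2
      omega
    have htot : sympInner (g a) P = 0 :=
      (mem_sympDual_iff.1 hPd) (g a) (Submodule.subset_span ⟨a, rfl⟩)
    rw [eq_sum_proj_slab β hPs, sympInner_sum_right] at htot
    have hjmem : j ∈ slabIndices β p := by
      simp only [slabIndices, mem_filter, mem_image, mem_univ, true_and]
      exact ⟨⟨q₀, hq₀j⟩, hj⟩
    rw [← Finset.add_sum_erase _ _ hjmem,
      Finset.sum_eq_zero (fun j' hj' => hother j' (Finset.mem_of_mem_erase hj')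
        (Finset.ne_of_mem_erase hj')), add_zero] at htot
    exact htot
  · push Not at hmeet
    exact sympInner_proj_slab_eq_zero β g hmeet P

/-- (i) If no slab supports a non-trivial logical operator, then an element of `S̄⊥` supported on the
slabs of one parity is a stabilizer («Since `P'_j` … its support is contained in a strip of width `≤ r`,
the assumption `d_1(S) > r` implies `P'_j ∈ S`»). [cite: BravyiTerhal2009, §2 proof of Prop. 1] -/
theorem mem_of_mem_supportedOn_parityClass {S : Submodule (ZMod 2) (SympVec n)}
    (hS : S = Submodule.span (ZMod 2) (Set.range g))
    (hsep : ∀ a, ∃ j₀ : ℕ, ∀ q ∈ sympSupport (g a), β q = j₀ ∨ β q = j₀ + 1)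
    (h0 : ∀ j, ∀ Q ∈ sympDual S, Q ∈ supportedOn (slab β j) → Q ∈ S)
    {p : ℕ} {P : SympVec n} (hPd : P ∈ sympDual S) (hPs : P ∈ supportedOn (parityClass β p)) :
    P ∈ S := by
  rw [eq_sum_proj_slab β hPs]
  refine Submodule.sum_mem _ fun j hj => h0 j _ ?_ (proj_mem_supportedOn _ P)
  have hj' : j % 2 = p := (mem_filter.1 hj).2
  subst hS
  exact proj_slab_mem_sympDual β g hsep hPd hPs hj'

/-- (ii) **Core of Theorem 1.** If `S̄ = ⟨g⟩` is self-orthogonal, every generator meets at most two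
adjacent slabs, and no single slab supports a non-trivial logical operator, then `S̄⊥ ≤ S̄` (no logical
qubits): clean the odd slabs (Cleaning Lemma, `sup_sympDual_inf_supportedOn_compl_eq`), the cleaned
logical lives on the even slabs and splits into stabilizers. [cite: BravyiTerhal2009, §2 proof of Prop. 1 and of Thm. 1] -/
theorem sympDual_le_of_slabs {S : Submodule (ZMod 2) (SympVec n)}
    (hS : S = Submodule.span (ZMod 2) (Set.range g)) (hself : IsSelfOrthogonal S)
    (hsep : ∀ a, ∃ j₀ : ℕ, ∀ q ∈ sympSupport (g a), β q = j₀ ∨ β q = j₀ + 1)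
    (h0 : ∀ j, ∀ Q ∈ sympDual S, Q ∈ supportedOn (slab β j) → Q ∈ S) : sympDual S ≤ S := by
  intro P hP
  have hU : (sympDual S ⊓ supportedOn (parityClass β 1) : Submodule (ZMod 2) (SympVec n)) ≤ S :=
    fun Q hQ => mem_of_mem_supportedOn_parityClass β g hS hsep h0 hQ.1 hQ.2
  have hP' : P ∈ S ⊔ (sympDual S ⊓ supportedOn (parityClass β 1)ᶜ) := by
    rw [sup_sympDual_inf_supportedOn_compl_eq hself hU]; exact hP
  obtain ⟨s, hs, q, hq, rfl⟩ := Submodule.mem_sup.1 hP'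
  have hqs : q ∈ supportedOn (parityClass β 0) := by rw [← compl_parityClass_one]; exact hq.2
  exact Submodule.add_mem _ hs (mem_of_mem_supportedOn_parityClass β g hS hsep h0 hq.1 hqs)

end Core

/-! ### The lattice: slabs of `w` columns along the first coordinate -/

section Lattice

variable {D L : ℕ}

/-- Slab index of a qubit: its `i₀`-th lattice coordinate divided by the slab width `w`.
[cite: BravyiTerhal2009, §2 proof of Prop. 1 (vertical strips)] -/
def colSlab (e : Fin n ≃ (Fin D → Fin L)) (i₀ : Fin D) (w : ℕ) (q : Fin n) : ℕ := ((e q) i₀ : ℕ) / w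

/-- A generator covered by a hypercube with `r^D` vertices spans at most `r ≤ w + 1` consecutive values
of any coordinate, hence meets at most two adjacent slabs of width `w`.
[cite: BravyiTerhal2009, §2 proof of Prop. 1 («each generator overlaps with at most one odd strip»)] -/
theorem slabPair_of_isCubeLocal {e : Fin n ≃ (Fin D → Fin L)} {r : ℕ} (i₀ : Fin D) {w : ℕ}
    (hw : 1 ≤ w) (hrw : r ≤ w + 1) {v : SympVec n} (hv : IsCubeLocal e r v) :
    ∃ j₀ : ℕ, ∀ q ∈ sympSupport v, colSlab e i₀ w q = j₀ ∨ colSlab e i₀ w q = j₀ + 1 := by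
  obtain ⟨c, hc⟩ := hv
  refine ⟨(c i₀ : ℕ) / w, fun q hq => ?_⟩
  obtain ⟨h1, h2⟩ := hc q hq i₀
  unfold colSlab
  have hlo : (c i₀ : ℕ) / w ≤ ((e q) i₀ : ℕ) / w := Nat.div_le_div_right h1
  have hhi : ((e q) i₀ : ℕ) / w ≤ (c i₀ : ℕ) / w + 1 := by
    calc ((e q) i₀ : ℕ) / w ≤ ((c i₀ : ℕ) + w) / w := Nat.div_le_div_right (by omega)
      _ = (c i₀ : ℕ) / w + 1 := Nat.add_div_right _ (by omega)
  omega

/-- The number of lattice points whose first coordinate lies in a set `C` of columns is `|C| · L^{D−1}`.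
[cite: BravyiTerhal2009, §2 proof of Thm. 1 («weight at most r L^{D−1}»)] -/
theorem card_filter_apply_zero_mem {D' : ℕ} (C : Finset (Fin L)) :
    #(univ.filter fun x : Fin (D' + 1) → Fin L => x 0 ∈ C) = #C * L ^ D' := by
  classical
  have hset : (univ.filter fun x : Fin (D' + 1) → Fin L => x 0 ∈ C) =
      (C ×ˢ (univ : Finset (Fin D' → Fin L))).map
        (Fin.consEquiv fun _ : Fin (D' + 1) => Fin L).toEmbedding := by
    ext x
    simp [Finset.mem_map_equiv, Fin.consEquiv]
  rw [hset, Finset.card_map, Finset.card_product, Finset.card_univ, Fintype.card_fun,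
    Fintype.card_fin, Fintype.card_fin]

/-- At most `w` columns have a given slab index. [cite: BravyiTerhal2009, §2 proof of Prop. 1 (strips of width r, r−1)] -/
theorem card_filter_div_eq_le (w : ℕ) (hw : 1 ≤ w) (j : ℕ) :
    #(univ.filter fun t : Fin L => (t : ℕ) / w = j) ≤ w := by
  calc #(univ.filter fun t : Fin L => (t : ℕ) / w = j)
      ≤ #(Finset.range w) := by
        refine Finset.card_le_card_of_injOn (fun t : Fin L => (t : ℕ) % w) ?_ ?_
        · intro t _
          simpa using Nat.mod_lt _ (by omega)
        · intro t₁ ht₁ t₂ ht₂ h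
          simp only [coe_filter, mem_univ, true_and, Set.mem_setOf_eq] at ht₁ ht₂
          apply Fin.ext
          rw [← Nat.div_add_mod (t₁ : ℕ) w, ← Nat.div_add_mod (t₂ : ℕ) w, ht₁, ht₂]
          simpa using h
    _ = w := Finset.card_range w

/-- **A slab of `w` columns holds at most `w · L^{D−1}` qubits** (so a logical operator supported in it
has weight `≤ w L^{D−1}`). [cite: BravyiTerhal2009, §2 proof of Thm. 1 («logical operator whose support is contained in a strip r × L, weight at most rL»)] -/
theorem card_colSlab_le {D' : ℕ} (e : Fin n ≃ (Fin (D' + 1) → Fin L)) (w : ℕ) (hw : 1 ≤ w) (j : ℕ) :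
    #(slab (colSlab e 0 w) j) ≤ w * L ^ D' := by
  classical
  set C : Finset (Fin L) := univ.filter fun t : Fin L => (t : ℕ) / w = j with hC
  have hslab : slab (colSlab e 0 w) j =
      (univ.filter fun x : Fin (D' + 1) → Fin L => x 0 ∈ C).map e.symm.toEmbedding := by
    ext q
    simp [slab, colSlab, hC, Finset.mem_map_equiv]
  rw [hslab, Finset.card_map, card_filter_apply_zero_mem]
  exact Nat.mul_le_mul_right _ (card_filter_div_eq_le w hw j)

end Lattice

/-! ### Theorem 1 -/

/-- **Bravyi–Terhal 2009, Theorem 1, proved** (discharge of `BravyiTerhal2009_d_le_c_sqrt_n`): a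
stabilizer code on `{1,…,L}^D` (`D ≥ 1`, open boundaries, any `L`) whose stabilizer space is spanned by
generators each covered by a hypercube with `r^D` vertices (`r ≥ 1`), encoding `k ≥ 1` qubits with
minimum distance `d`, has `d ≤ r · L^{D−1}`. [cite: BravyiTerhal2009, §1.1 Thm. 1 (p. 4); proof §2 Lemma 1, Prop. 1] -/
theorem BravyiTerhal2009_d_le_c_sqrt_n_holds : BravyiTerhal2009_d_le_c_sqrt_n := by
  intro D L r n k d e S hD hr hloc hcode hk
  obtain ⟨D', rfl⟩ : ∃ D', D = D' + 1 := ⟨D - 1, by omega⟩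
  rw [Nat.add_sub_cancel]
  -- slab width w = max (r - 1) 1
  set w : ℕ := max (r - 1) 1 with hwdef
  have hw1 : 1 ≤ w := le_max_right _ _
  have hrw : r ≤ w + 1 := by have := le_max_left (r - 1) 1; omega
  have hwr : w ≤ r := max_le (Nat.sub_le r 1) hr
  by_contra hlt
  push Not at hlt
  -- the local generators
  set T : Set (SympVec n) := {v | v ∈ S ∧ IsCubeLocal e r v} with hT
  have hS : S = Submodule.span (ZMod 2) (Set.range (Subtype.val : T → SympVec n)) := by
    rw [Subtype.range_coe]
    exact le_antisymm hloc (Submodule.span_le.2 fun v hv => hv.1)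
  have hsep : ∀ a : T, ∃ j₀ : ℕ, ∀ q ∈ sympSupport (a : SympVec n),
      colSlab e 0 w q = j₀ ∨ colSlab e 0 w q = j₀ + 1 :=
    fun a => slabPair_of_isCubeLocal 0 hw1 hrw a.2.2
  -- no slab supports a non-trivial logical operator (it would have weight ≤ w L^{D'} ≤ r L^{D'} < d)
  have h0 : ∀ j, ∀ Q ∈ sympDual S, Q ∈ supportedOn (slab (colSlab e 0 w) j) → Q ∈ S := by
    intro j Q hQd hQs
    by_contra hQS
    have h1 := hcode.2.2.1 Q hQd hQS
    have h2 := sympWeight_le_card_of_mem hQs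
    have h3 := card_colSlab_le e w hw1 j
    have h4 : w * L ^ D' ≤ r * L ^ D' := Nat.mul_le_mul_right _ hwr
    omega
  -- hence S⊥ ≤ S, contradicting k ≥ 1
  have hle := Submodule.finrank_mono (sympDual_le_of_slabs (colSlab e 0 w) _ hS hcode.1 hsep h0)
  rw [hcode.finrank_sympDual] at hle
  have hdim := hcode.2.1
  omega

end Literature.InformationTheory.QuantumCodes
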